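import Mathlib
import Summits.ResolutionOfSingularities.ResolutionOfSingularities.Theorems.WildQuotientsWildQuotientResolutionToricChartDefs
/-!
# Toric chart certificates — algebraic lemmas (words, the presentation, Laurent monomial maps)

(crux stmt-ResolutionOfSingularities-15640 `WildQuotients.WildQuotientResolution`, line `Sketch`,
sector `|G| = p`; next rung R-T — the cone lane, soundness of toric chart certificates, part 2/4.
[OURS · L1 W4.5c] — NOT a statement of any manuscript; replaces the role of no printed item.
Prover res-L1-w45c-stub-4 (gen 4).)

* `presentation_wordPoly` — the presentation of a word is the monomial of its exponent, so
  `wordElem_eq_of_wordExp_eq`: words with equal exponents give the same ring element;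
* `theta_injective`, `theta_wordElem`, `wordElem_ne_zero`, `isDomain_ring`;
* `aeval_laurentMonomial_injective` — a Laurent monomial substitution `x_v ↦ x^{B_v}` with injective
  exponent map is injective (`Finsupp.mapDomain` on the monoid algebra);
* `toLaurent_xmon`, `isUnit_single`, and the product bookkeeping `prod_xmon_pow`,
  `prod_pow_mem_pow`, `prod_mul_pow_pow`, `prod_monomial`, `theta_num`, `theta_prod_num_pow`.
-/

-- single-problem summit: the doubled namespace component `ResolutionOfSingularities` is forced
set_option linter.dupNamespace false

noncomputable section

open MvPolynomial

namespace Summit.ResolutionOfSingularities.ResolutionOfSingularities.Theorems.WildQuotientResolution.ToricChart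

variable {d r : ℕ}

/-- `fsum` is the `Finset` sum. [folklore] -/
theorem fsum_eq_sum {α : Type} [AddCommMonoid α] : ∀ (n : ℕ) (f : Fin n → α),
    fsum n f = ∑ i, f i
  | 0, f => by simp [fsum]
  | n + 1, f => by rw [fsum, Fin.sum_univ_succ, fsum_eq_sum n]

section Ring

variable {k : Type} [Field k] {P : Type} {D : ConeDatum d r}

/-- `xmon (e₁ + e₂) = xmon e₁ * xmon e₂`. [folklore] -/
theorem xmon_add (e₁ e₂ : Fin d → ℕ) : xmon k P (e₁ + e₂) = xmon k P e₁ * xmon k P e₂ := by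
  simp only [xmon, Pi.add_apply, pow_add, Finset.prod_mul_distrib]

/-- `xmon (n • e) = xmon e ^ n`. [folklore] -/
theorem xmon_smul (n : ℕ) (e : Fin d → ℕ) : xmon k P (n • e) = xmon k P e ^ n := by
  rw [xmon, xmon, ← Finset.prod_pow]
  refine Finset.prod_congr rfl fun s _ => ?_
  rw [Pi.smul_apply, smul_eq_mul, mul_comm, pow_mul]

/-- `xmon 0 = 1`. [folklore] -/
theorem xmon_zero : xmon k P (0 : Fin d → ℕ) = 1 := by
  simp [xmon]

/-- `xmon e ≠ 0`. [folklore] -/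
theorem xmon_ne_zero (e : Fin d → ℕ) : xmon k P e ≠ 0 := by
  rw [xmon, Finset.prod_ne_zero_iff]
  exact fun s _ => pow_ne_zero _ (X_ne_zero _)

/-- `∏ xmon (f l) ^ n l = xmon (∑ n l • f l)`. [folklore] -/
theorem prod_xmon_pow {ι : Type} (F : Finset ι) (f : ι → Fin d → ℕ) (n : ι → ℕ) :
    ∏ l ∈ F, xmon k P (f l) ^ n l = xmon k P (∑ l ∈ F, n l • f l) := by
  classical
  induction F using Finset.induction_on with
  | empty => simp [xmon_zero]
  | insert j F hj ih =>
    rw [Finset.prod_insert hj, Finset.sum_insert hj, xmon_add, xmon_smul, ih]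

/-- The presentation on a pure symbol. [OURS · L1 W4.5c] -/
theorem presentation_X_inl_inl (s : Fin d) :
    presentation k P D (X (Sum.inl (Sum.inl s))) = X (Sum.inl s) ^ D.pw s := by
  simp [presentation]

/-- The presentation on a passenger. [OURS · L1 W4.5c] -/
theorem presentation_X_inl_inr (p : P) :
    presentation k P D (X (Sum.inl (Sum.inr p))) = X (Sum.inr p) := by
  simp [presentation]

/-- The presentation on a mixed symbol. [OURS · L1 W4.5c] -/
theorem presentation_X_inr (j : Fin r) :
    presentation k P D (X (Sum.inr j)) = xmon k P (D.mx j) := by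
  simp [presentation, xmon]

/-- **The presentation of a word is the monomial of its exponent.** [OURS · L1 W4.5c] -/
theorem presentation_wordPoly (w : Word d r) :
    presentation k P D (wordPoly k P w) = xmon k P (wordExp D w) := by
  have h1 : presentation k P D (∏ s : Fin d, X (Sum.inl (Sum.inl s)) ^ w.wp s) =
      xmon k P (fun s => D.pw s * w.wp s) := by
    rw [map_prod]
    simp only [map_pow, presentation_X_inl_inl, ← pow_mul]
    rfl
  have h2 : presentation k P D (∏ j : Fin r, X (Sum.inr j) ^ w.wm j) =
      xmon k P (fun s => fsum r fun j => w.wm j * D.mx j s) := by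
    rw [map_prod]
    simp only [map_pow, presentation_X_inr]
    have : (fun s => fsum r fun j => w.wm j * D.mx j s) = ∑ j : Fin r, (w.wm j • D.mx j) := by
      funext s
      rw [fsum_eq_sum, Finset.sum_apply]
      rfl
    rw [this]
    exact prod_xmon_pow _ _ _
  rw [wordPoly, map_mul, h1, h2, ← xmon_add]
  rfl

/-- Two polynomials in the symbols with the same presentation have the same class in `A`.
[folklore] -/
theorem mk_eq_of_presentation_eq {F G : MvPolynomial ((Fin d ⊕ P) ⊕ Fin r) k}
    (h : presentation k P D F = presentation k P D G) :
    (Ideal.Quotient.mk (RingHom.ker (presentation k P D)) F : Ring k P D) =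
      Ideal.Quotient.mk _ G := by
  rw [Ideal.Quotient.eq, RingHom.mem_ker, map_sub, sub_eq_zero]
  exact h

/-- **Words with equal exponents define the same element of `A`.** [OURS · L1 W4.5c] -/
theorem wordElem_eq_of_wordExp_eq {w₁ w₂ : Word d r} (h : wordExp D w₁ = wordExp D w₂) :
    wordElem k P D w₁ = wordElem k P D w₂ :=
  mk_eq_of_presentation_eq (by rw [presentation_wordPoly, presentation_wordPoly, h])

/-- `θ (mk F) = presentation F`. [folklore] -/
theorem theta_mk (F : MvPolynomial ((Fin d ⊕ P) ⊕ Fin r) k) :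
    theta (k := k) (P := P) (D := D) (Ideal.Quotient.mk _ F) = presentation k P D F :=
  rfl

/-- `θ` is injective. [folklore] -/
theorem theta_injective : Function.Injective (theta (k := k) (P := P) (D := D)) := by
  rw [injective_iff_map_eq_zero]
  intro x hx
  obtain ⟨F, rfl⟩ := Ideal.Quotient.mk_surjective x
  rw [theta_mk] at hx
  exact Ideal.Quotient.eq_zero_iff_mem.mpr hx

/-- `θ (wordElem w) = xmon (wordExp w)`. [OURS · L1 W4.5c] -/
theorem theta_wordElem (w : Word d r) :
    theta (k := k) (P := P) (D := D) (wordElem k P D w) = xmon k P (wordExp D w) := by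
  rw [wordElem, theta_mk, presentation_wordPoly]

/-- `wordElem w ≠ 0`. [OURS · L1 W4.5c] -/
theorem wordElem_ne_zero (w : Word d r) : wordElem k P D w ≠ 0 := by
  intro h
  have := congrArg (theta (k := k) (P := P) (D := D)) h
  rw [theta_wordElem, map_zero] at this
  exact xmon_ne_zero _ this

/-- `A` is a domain. [folklore] -/
theorem isDomain_ring : IsDomain (Ring k P D) := by
  haveI : (RingHom.ker (presentation k P D)).IsPrime := RingHom.ker_isPrime _
  exact (Ideal.Quotient.isDomain_iff_prime _).mpr inferInstance

/-- The word of a pure symbol is that symbol. [OURS · L1 W4.5c] -/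
theorem wordPoly_pureWord (s' : Fin d) :
    wordPoly k P (pureWord s' : Word d r) = X (Sum.inl (Sum.inl s')) := by
  classical
  rw [wordPoly]
  simp only [pureWord, pow_zero, Finset.prod_const_one, mul_one]
  rw [Finset.prod_eq_single s']
  · simp
  · intro s _ hs; simp [hs]
  · intro h; exact absurd (Finset.mem_univ s') h

/-- The word of a mixed symbol is that symbol. [OURS · L1 W4.5c] -/
theorem wordPoly_mixedWord (j : Fin r) :
    wordPoly k P (mixedWord j : Word d r) = X (Sum.inr j) := by
  classical
  rw [wordPoly]
  simp only [mixedWord, pow_zero, Finset.prod_const_one, one_mul]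
  rw [Finset.prod_eq_single j]
  · simp
  · intro j' _ hj; simp [hj]
  · intro h; exact absurd (Finset.mem_univ j) h

variable {m : ℕ} {G : Fin m → Word d r} {C : ChartCert d r m}

/-- `θ (num s) = xmon (nexp s)`. [OURS · L1 W4.5c] -/
theorem theta_num (s : Fin d) :
    theta (num k P D G C s) = xmon k P (fun t => C.nexp D G s t) := by
  rw [num, map_mul, map_prod]
  simp only [map_pow, theta_wordElem]
  rw [prod_xmon_pow, ← xmon_add]
  congr 1
  funext t
  rw [Pi.add_apply, Finset.sum_apply, ChartCert.nexp, fsum_eq_sum]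
  simp only [Pi.smul_apply, smul_eq_mul]

/-- `θ (∏ wordElem (G l) ^ n l · x) = xmon (Σ n l • wordExp (G l)) * θ x`-type bookkeeping:
`θ` of a product of powers of the `num s`. [OURS · L1 W4.5c] -/
theorem theta_prod_num_pow (c : Fin d → ℕ) :
    theta (∏ s : Fin d, num k P D G C s ^ c s) =
      xmon k P (fun t => fsum d fun s => c s * C.nexp D G s t) := by
  rw [map_prod]
  simp only [map_pow, theta_num]
  rw [prod_xmon_pow]
  congr 1
  funext t
  rw [Finset.sum_apply, fsum_eq_sum]
  simp only [Pi.smul_apply, smul_eq_mul]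

end Ring

section Laurent

variable {k : Type} [Field k] {V : Type}

/-- **A Laurent monomial substitution with injective exponent map is injective**: for
`B : V → (V →₀ ℤ)` with `e ↦ Σ_v e_v • B_v` injective on `V →₀ ℕ`, the `k`-algebra map
`k[x] → k[x^{±1}]`, `x_v ↦ x^{B_v}`, is injective (it is `Finsupp.mapDomain` of the exponent map).
[folklore] -/
theorem aeval_laurentMonomial_injective (B : V → (V →₀ ℤ))
    (hB : Function.Injective (fun e : V →₀ ℕ => e.sum fun v n => (n : ℤ) • B v)) :
    Function.Injective (MvPolynomial.aeval (R := k) (S₁ := Laurent k V)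
      (fun v => AddMonoidAlgebra.single (B v) (1 : k))) := by
  classical
  let L : (V →₀ ℕ) →+ (V →₀ ℤ) :=
    { toFun := fun e => e.sum fun v n => (n : ℤ) • B v
      map_zero' := by simp
      map_add' := fun e e' => by
        rw [Finsupp.sum_add_index']
        · intro v; simp
        · intro v n n'; simp [add_smul] }
  have hL' : ∀ e : V →₀ ℕ, L e = e.sum fun v n => (n : ℤ) • B v := fun e => rfl
  have hLinj : Function.Injective L := hB
  let Φ : MvPolynomial V k →ₐ[k] Laurent k V := AddMonoidAlgebra.mapDomainAlgHom k k L
  have hΦ : ∀ g : MvPolynomial V k, Φ g = AddMonoidAlgebra.mapDomain L g := fun g => by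
    simp [Φ]
  have hΦinj : Function.Injective Φ := by
    intro f g h
    rw [hΦ, hΦ] at h
    exact AddMonoidAlgebra.mapDomain_injective hLinj h
  have key : MvPolynomial.aeval (R := k) (S₁ := Laurent k V)
      (fun v => AddMonoidAlgebra.single (B v) (1 : k)) = Φ := by
    refine MvPolynomial.algHom_ext fun v => ?_
    rw [aeval_X, hΦ]
    have hX : (X v : MvPolynomial V k) = AddMonoidAlgebra.single (Finsupp.single v 1) (1 : k) := rfl
    rw [hX, AddMonoidAlgebra.mapDomain_single, hL', Finsupp.sum_single_index (by simp)]
    simp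
  rw [key]
  exact hΦinj

/-- `toLaurent (X v) = x_v`. [folklore] -/
theorem toLaurent_X (v : V) :
    toLaurent k V (X v) = AddMonoidAlgebra.single (Finsupp.single v (1 : ℤ)) (1 : k) := by
  simp [toLaurent]

/-- `toLaurent` of a product of powers of variables is a Laurent monomial. [folklore] -/
theorem toLaurent_prod_X_pow {ι : Type} (F : Finset ι) (v : ι → V) (e : ι → ℕ) :
    toLaurent k V (∏ i ∈ F, X (v i) ^ e i) =
      AddMonoidAlgebra.single (∑ i ∈ F, e i • Finsupp.single (v i) (1 : ℤ)) (1 : k) := by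
  classical
  induction F using Finset.induction_on with
  | empty => rw [Finset.prod_empty, Finset.sum_empty, map_one, AddMonoidAlgebra.one_def]
  | insert j F hj ih =>
    rw [Finset.prod_insert hj, Finset.sum_insert hj, map_mul, map_pow, toLaurent_X, ih,
      AddMonoidAlgebra.single_pow, one_pow, AddMonoidAlgebra.single_mul_single, one_mul]

/-- The inverse of a Laurent monomial. [folklore] -/
theorem single_mul_single_neg (a : V →₀ ℤ) :
    (AddMonoidAlgebra.single a (1 : k) : Laurent k V) * AddMonoidAlgebra.single (-a) (1 : k) = 1 := by
  rw [AddMonoidAlgebra.single_mul_single, add_neg_cancel, mul_one, AddMonoidAlgebra.one_def]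

/-- A Laurent monomial is a unit. [folklore] -/
theorem isUnit_single (a : V →₀ ℤ) : IsUnit (AddMonoidAlgebra.single a (1 : k) : Laurent k V) :=
  isUnit_iff_exists_inv.mpr ⟨_, single_mul_single_neg a⟩

end Laurent

section LaurentX

variable {k : Type} [Field k] {P : Type}

/-- `toLaurent (xmon e)` is the Laurent monomial of `e`. [folklore] -/
theorem toLaurent_xmon (e : Fin d → ℕ) :
    toLaurent k (Fin d ⊕ P) (xmon k P e) =
      AddMonoidAlgebra.single (∑ s : Fin d, e s • Finsupp.single (Sum.inl s) (1 : ℤ)) (1 : k) :=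
  toLaurent_prod_X_pow _ _ _

end LaurentX

section Products

/-- A product of powers of elements of `J` lies in the corresponding power of `J`. [folklore] -/
theorem prod_pow_mem_pow {A : Type} [CommRing A] (J : Ideal A) {ι : Type} (F : Finset ι)
    (x : ι → A) (hx : ∀ i ∈ F, x i ∈ J) (n : ι → ℕ) :
    ∏ i ∈ F, x i ^ n i ∈ J ^ (∑ i ∈ F, n i) := by
  classical
  induction F using Finset.induction_on with
  | empty => simp
  | insert j F hj ih =>
    rw [Finset.prod_insert hj, Finset.sum_insert hj, pow_add]
    exact Ideal.mul_mem_mul (Ideal.pow_mem_pow (hx j (Finset.mem_insert_self j F)) _)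
      (ih fun i hi => hx i (Finset.mem_insert_of_mem hi))

/-- Product of powers of fractions `a_i ι^{e_i}`. [folklore] -/
theorem prod_mul_pow_pow {L : Type} [CommRing L] {ι : Type} (F : Finset ι) (a : ι → L) (ι' : L)
    (e c : ι → ℕ) :
    ∏ i ∈ F, (a i * ι' ^ e i) ^ c i = (∏ i ∈ F, a i ^ c i) * ι' ^ (∑ i ∈ F, c i * e i) := by
  classical
  induction F using Finset.induction_on with
  | empty => simp
  | insert j F hj ih =>
    rw [Finset.prod_insert hj, Finset.prod_insert hj, Finset.sum_insert hj, ih]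
    ring

/-- `∏ monomial (n i) (a i) = monomial (Σ n i) (∏ a i)` in `A[t]`. [folklore] -/
theorem prod_monomial {A : Type} [CommSemiring A] {ι : Type} (F : Finset ι) (n : ι → ℕ) (a : ι → A) :
    ∏ i ∈ F, Polynomial.monomial (n i) (a i) = Polynomial.monomial (∑ i ∈ F, n i) (∏ i ∈ F, a i) := by
  classical
  induction F using Finset.induction_on with
  | empty => simp
  | insert j F hj ih =>
    rw [Finset.prod_insert hj, Finset.sum_insert hj, Finset.prod_insert hj, ih,
      Polynomial.monomial_mul_monomial]

end Products

end Summit.ResolutionOfSingularities.ResolutionOfSingularities.Theorems.WildQuotientResolution.ToricChart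

end
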